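import Literature.Analysis.FluidPDE.KatoLaiCellIdentification
import HarnessLib

/-!
# Kato–Lai in the periodic cylinder: level runs from a cell datum and their velocity

Analysis/FluidPDE support file for the energy-method construction of Euler flows in the
periodic cylinder (`Literature.Analysis.FluidPDE.KatoLai1984_periodicCylinderUniformExistence`;
Kato–Lai 1984, Thm I, Thm II, §6). From a smooth periodic cell datum `φ`, divergence free and
tangential, the level-`s` construction (`KatoLaiLevelPath.exists_levelPath`) is run for every
`s ≥ 7` on the **same** interval `[0, T♯]`, `T♯ = sharpTime (lowE (toL2 U₀) + 1)`,
`U₀ = torusRep L φ` (a **level run**, `LevelRun`). This file proves: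

* `exists_levelRun` — level runs exist for every `s ≥ 7`;
* `LevelRun.eqOn_pathVel` — **all level runs have the same velocity on the closed cylinder**
  (uniqueness of cell paths, `IsCellPath.eq`, and `AtLevel.eqOn_fromTorus_physVel`);
* `LevelRun.contDiffOn_pathVel`, `LevelRun.contDiffOn_pathVel_infty` — hence **the velocity is
  jointly `C^∞` on `[0, T♯] × closed cylinder`** (order `n` from the run at level `3n + 7`), with
  smooth periodic slices (`LevelRun.isSmoothPeriodic_pathVel`) and initial slice `φ`
  (`LevelRun.pathVel_zero_eqOn`);
* `LevelRun.hasDerivWithinAt_pathVel` — **the Euler equation**: within `[0, T♯]`, at `t < T♯` and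
  `x` in the open cylinder, `∂ₜ u = −((u·∇)u − ∇_K π)` with `π` Kato–Lai's pressure of `u(t)`;
  `LevelRun.divergence_slip` — `u(t)` is divergence free and tangential;
* `lowE_toL2_le`, `sharpTime_antitone` — the size bookkeeping for the uniform existence time.

Everything is proved; no named fact and no `sorry` is introduced.

## References

* T. Kato, C. Y. Lai, J. Funct. Anal. 56 (1984) 15–28, Thm I, Thm II, §6. [KatoLai1984]
-/

noncomputable section

open MeasureTheory Set Function Filter Topology TopologicalSpace
open scoped NNReal ENNReal InnerProductSpace RealInnerProductSpace ContDiff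

namespace Literature.Analysis.FluidPDE

open FunctionSpaces FunctionSpaces.Torus UnitAddTorus

/-- Local notation for physical space `ℝ³ = EuclideanSpace ℝ (Fin 3)`. -/
local notation "ℝ³" => EuclideanSpace ℝ (Fin 3)

/-- Local notation for the closed cylinder `{r ≤ 1}`. -/
local notation "𝕂" => closure (SetLike.coe unitCylinder : Set (EuclideanSpace ℝ (Fin 3)))

namespace PeriodicCylinder

variable {L : ℝ} (hL : 0 < L)

/-! ### Size bookkeeping -/

section Size

/-- **The level-`3` energy of a smooth datum by its lattice energy**:
`lowE (toL2 U) ≤ (1 + 3(2π)⁶) lat₃(U)`. [folklore] -/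
theorem lowE_toL2_le {U : UnitAddTorus (Fin 3) → ℝ³} (hU : IsSmooth U) :
    lowE (toL2 hU) ≤ (1 + 3 * (2 * Real.pi) ^ (2 * 3)) * Torus.latNormSq 3 U := by
  set c : ℝ := 1 + 3 * (2 * Real.pi) ^ (2 * 3) with hc
  have hg : Summable fun k : Fin 3 → ℤ => c * ((1 + freqNormSq k) ^ 3 * ‖mFourierCoeff (EuclideanSpace.complexify ∘ U) k‖ ^ 2) :=
    (Torus.summable_latWeight hU 3).mul_left c
  have hk : ∀ k, ‖(toL2 hU) k‖ = ‖mFourierCoeff (EuclideanSpace.complexify ∘ U) k‖ := fun k => by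
    rw [SymL2.ofSmooth_apply]; simp
  have hle : ∀ k, pureSq 3 k * ‖(toL2 hU) k‖ ^ 2 ≤ c * ((1 + freqNormSq k) ^ 3 * ‖mFourierCoeff (EuclideanSpace.complexify ∘ U) k‖ ^ 2) :=
    fun k => by
      rw [hk, ← mul_assoc]
      exact mul_le_mul_of_nonneg_right (pureSq_le_latWeight k 3) (sq_nonneg _)
  have hf : Summable fun k => pureSq 3 k * ‖(toL2 hU) k‖ ^ 2 :=
    .of_nonneg_of_le (fun k => mul_nonneg (zero_le_one.trans (one_le_pureSq 3 k)) (sq_nonneg _)) hle hg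
  calc lowE (toL2 hU) = ∑' k, pureSq 3 k * ‖(toL2 hU) k‖ ^ 2 := rfl
    _ ≤ ∑' k, c * ((1 + freqNormSq k) ^ 3 * ‖mFourierCoeff (EuclideanSpace.complexify ∘ U) k‖ ^ 2) := hf.tsum_le_tsum hle hg
    _ = c * Torus.latNormSq 3 U := by rw [tsum_mul_left]; rfl

/-- `T♯` decreases with the size. [folklore] -/
theorem sharpTime_antitone {Y Y' : ℝ} (hY : 0 < Y) (h : Y ≤ Y') : sharpTime hL Y' ≤ sharpTime hL Y := by
  unfold sharpTime
  have hK := lowK_pos hL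
  have h1 : Real.sqrt Y ≤ Real.sqrt Y' := Real.sqrt_le_sqrt h
  have h2 : 0 < Real.sqrt Y := Real.sqrt_pos.2 hY
  exact one_div_le_one_div_of_le (by positivity) (by nlinarith)

end Size

/-! ### Level runs -/

section Runs

/-- **A level-`s` run** from the smooth torus datum `U₀` on `[0, T]`: a coefficient path starting at
`toL2 U₀`, windowed at level `s`, whose cell restriction is a cell path.
[cite: KatoLai1984, Thm I, §6] -/
structure LevelRun (s : ℕ) {U₀ : UnitAddTorus (Fin 3) → ℝ³} (hU₀ : IsSmooth U₀) (T : ℝ) (G : ℝ → SymL2 (Fin 3)) : Prop where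
  /-- the initial value -/
  init : G 0 = toL2 hU₀
  /-- windows at level `s` -/
  windowed : ∃ δ : ℝ, IsWindowed hL s δ T G
  /-- the cell restriction is a cell path -/
  cellPath : ∃ ρ : ℝ, IsCellPath hL ρ T fun t => cellRestrict hL (G t)

variable {φ : ℝ³ → ℝ³} (hφ : IsSmoothPeriodic L φ)
  (hdiv : ∀ x ∈ (unitCylinder : Set ℝ³), VectorCalculus.divergence φ x = 0)
  (hslip : ∀ x ∈ frontier (unitCylinder : Set ℝ³), ⟪φ x, eR x⟫_ℝ = 0)

include hdiv hslip in
/-- The cell datum, divergence free and tangential, has no gradient part at any level. [cite: KatoLai1984, §5 (p. 23)] -/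
theorem helmholtzProj_cellRestrict_datum_eq_zero (s : ℕ) (ε : ℝ) :
    helmholtzProj L (cellRestrict hL (embed s ε (toSym s ε (isSmooth_torusRep hφ)))) = 0 := by
  rw [embed_toSym, cellRestrict_toL2, cellOf,
    toCell_congr fun x hx => fromTorus_torusRep_of_mem_K hL hφ.periodic (subset_closure (cylinderCell_le_unitCylinder L hx))]
  exact helmholtzProj_toCell_eq_zero hL hφ hdiv hslip

include hdiv hslip in
/-- **Level runs exist for every `s ≥ 7`**, on `[0, T♯]` with `T♯ = sharpTime (lowE (toL2 U₀) + 1)`.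
[cite: KatoLai1984, Thm I, Thm II, §6] -/
theorem exists_levelRun {s : ℕ} (hs7 : 7 ≤ s) :
    ∃ G, LevelRun hL s (isSmooth_torusRep hφ) (sharpTime hL (lowE (toL2 (isSmooth_torusRep hφ)) + 1)) G := by
  have hs3 : 3 ≤ s := by omega
  obtain ⟨G, h0, -, hP, -, -, hwinR, hwinL⟩ :=
    exists_levelPath hL hs7 one_pos (toSym s 1 (isSmooth_torusRep hφ)) (helmholtzProj_cellRestrict_datum_eq_zero hL hφ hdiv hslip s 1)
  rw [embed_toSym] at h0 hP hwinR hwinL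
  have hY : 0 < lowE (toL2 (isSmooth_torusRep hφ)) + 1 := by have := lowE_nonneg (toL2 (isSmooth_torusRep hφ)); positivity
  refine ⟨G, h0, ⟨winLen hL hs3 (lowE (toL2 (isSmooth_torusRep hφ)) + 1), ?_⟩, ⟨_, hP⟩⟩
  exact
    { hδ := winLen_pos hL hs3 _
      hT := sharpTime_pos hL hY
      right := fun t ht => by
        obtain ⟨ε, tw, φw, u, hε, hu, -, h1, -, h3, hG, -⟩ := hwinR t ⟨ht.1, ht.2.le⟩
        exact ⟨ε, tw, φw, u, hε.ne', hu, h1, h3 ht.2, hG⟩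
      left := fun t ht => by
        obtain ⟨ε, tw, φw, u, hε, hu, -, h1, h2, hG, -⟩ := hwinL t ht
        exact ⟨ε, tw, φw, u, hε.ne', hu, h1, h2, hG⟩ }

variable {hL}
variable {s s' : ℕ} {U₀ : UnitAddTorus (Fin 3) → ℝ³} {hU₀ : IsSmooth U₀} {T : ℝ} {G G' : ℝ → SymL2 (Fin 3)}

/-- **All level runs have the same cell restriction.** [cite: KatoLai1984, §6 (uniqueness)] -/
theorem LevelRun.cellRestrict_eq (h : LevelRun hL s hU₀ T G) (h' : LevelRun hL s' hU₀ T G') {t : ℝ} (ht : t ∈ Icc 0 T) :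
    cellRestrict hL (G t) = cellRestrict hL (G' t) := by
  obtain ⟨ρ, hP⟩ := h.cellPath
  obtain ⟨ρ', hP'⟩ := h'.cellPath
  have h0 : cellRestrict hL (G 0) = cellRestrict hL (G' 0) := by rw [h.init, h'.init]
  exact IsCellPath.eq hL hP hP' h0 t ht

/-- **All level runs have the same velocity on the closed cylinder.** [cite: KatoLai1984, §6] -/
theorem LevelRun.eqOn_pathVel (h : LevelRun hL s hU₀ T G) (h' : LevelRun hL s' hU₀ T G') (hs : 2 ≤ s) (hs' : 2 ≤ s') {t : ℝ}
    (ht : t ∈ Icc 0 T) : EqOn (pathVel L G t) (pathVel L G' t) 𝕂 := by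
  obtain ⟨δ, hW⟩ := h.windowed
  obtain ⟨δ', hW'⟩ := h'.windowed
  exact AtLevel.eqOn_fromTorus_physVel hL le_rfl (hW.atLevel_levRead (by omega) hs ht) (hW'.atLevel_levRead (by omega) hs' ht)
    (h.cellRestrict_eq h' ht)

/-- The time interval of a level run is non-degenerate. [folklore] -/
theorem LevelRun.pos (h : LevelRun hL s hU₀ T G) : 0 < T := by
  obtain ⟨δ, hW⟩ := h.windowed; exact hW.hT

/-- **Joint `C^n` regularity of the velocity on `[0, T] × closed cylinder`**, for a run at any level
`s ≥ 2`, provided runs exist at all levels `≥ 7` (order `n` is read off the run at level `3n + 7`).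
[cite: KatoLai1984, Thm I] -/
theorem LevelRun.contDiffOn_pathVel (h : LevelRun hL s hU₀ T G) (hs : 2 ≤ s) (hex : ∀ s', 7 ≤ s' → ∃ G', LevelRun hL s' hU₀ T G')
    (n : ℕ) : ContDiffOn ℝ n (uncurry (pathVel L G)) (Icc 0 T ×ˢ 𝕂) := by
  obtain ⟨G', h'⟩ := hex (3 * n + 7) (by omega)
  obtain ⟨δ', hW'⟩ := h'.windowed
  have hreg := hW'.contDiffOn_pathVel (n := n) (p := 2 * n + 4) le_rfl (by omega)
  refine (hreg.mono (prod_mono Subset.rfl (subset_univ _))).congr ?_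
  rintro ⟨t, x⟩ ⟨ht, hx⟩
  exact h.eqOn_pathVel h' hs (by omega) ht hx

/-- **The velocity is jointly `C^∞` on `[0, T] × closed cylinder.** [cite: KatoLai1984, Thm I] -/
theorem LevelRun.contDiffOn_pathVel_infty (h : LevelRun hL s hU₀ T G) (hs : 2 ≤ s)
    (hex : ∀ s', 7 ≤ s' → ∃ G', LevelRun hL s' hU₀ T G') : ContDiffOn ℝ ∞ (uncurry (pathVel L G)) (Icc 0 T ×ˢ 𝕂) :=
  contDiffOn_infty.2 fun n => h.contDiffOn_pathVel hs hex n

/-- The slices of the velocity are smooth periodic fields on the closed cylinder. [folklore] -/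
theorem LevelRun.isSmoothPeriodic_pathVel (h : LevelRun hL s hU₀ T G) (hs : 2 ≤ s) (hex : ∀ s', 7 ≤ s' → ∃ G', LevelRun hL s' hU₀ T G')
    {t : ℝ} (ht : t ∈ Icc 0 T) : IsSmoothPeriodic L (pathVel L G t) := by
  refine ⟨?_, isAxiallyPeriodic_pathVel hL.ne' G t⟩
  have hc : ContDiff ℝ ∞ (fun x : ℝ³ => ((t, x) : ℝ × ℝ³)) := contDiff_const.prodMk contDiff_id
  have := (h.contDiffOn_pathVel_infty hs hex).comp hc.contDiffOn fun x hx => ⟨ht, hx⟩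
  simpa [Function.comp_def] using this

/-- **The initial slice is the datum** on the closed cylinder (for `U₀ = torusRep L φ`). [folklore] -/
theorem LevelRun.pathVel_zero_eqOn {φ : ℝ³ → ℝ³} (hφ : IsSmoothPeriodic L φ) {G : ℝ → SymL2 (Fin 3)}
    (h : LevelRun hL s (isSmooth_torusRep hφ) T G) : EqOn (pathVel L G 0) φ 𝕂 := by
  rw [pathVel_eq_of_eq_toL2 (isSmooth_torusRep hφ) h.init]
  exact fun x hx => fromTorus_torusRep_of_mem_K hL hφ.periodic hx

/-- **The Euler equation of a level run** (`s ≥ 6`): within `[0, T]`, at `t < T` and `x` in the open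
cylinder, `∂ₜ u(t, x) = −((u·∇)u (x) − ∇_K π (x))`, `π` Kato–Lai's pressure of the smooth periodic
slice `u(t)`. [cite: KatoLai1984, Thm I, §5 (5.6)] -/
theorem LevelRun.hasDerivWithinAt_pathVel (h : LevelRun hL s hU₀ T G) (hs : 6 ≤ s) {t : ℝ} (ht : t ∈ Ico 0 T)
    (hv : IsSmoothPeriodic L (pathVel L G t)) {x : ℝ³} (hx : x ∈ (unitCylinder : Set ℝ³)) :
    HasDerivWithinAt (fun τ => pathVel L G τ x)
      (-(convect (pathVel L G t) (pathVel L G t) x -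
        pressureGrad hL (isSmoothPeriodic_fromTorus hL.ne' (isSmooth_torusRep hv)) x)) (Icc 0 T) t := by
  obtain ⟨δ, hW⟩ := h.windowed
  obtain ⟨ρ, hP⟩ := h.cellPath
  have hd := hW.hasDerivWithinAt_pathVel hs ⟨ht.1, ht.2.le⟩ x
  rwa [hW.physVel_pathAcc_eq_convect_sub_pressureGrad hs hP ht hv hx] at hd

/-- The slices of a level run are divergence free and tangential. [cite: KatoLai1984, §5 (p. 23)] -/
theorem LevelRun.divergence_slip (h : LevelRun hL s hU₀ T G) (hs : 2 ≤ s) {t : ℝ} (ht : t ∈ Icc 0 T)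
    (hv : IsSmoothPeriodic L (pathVel L G t)) :
    (∀ x ∈ (unitCylinder : Set ℝ³), VectorCalculus.divergence (pathVel L G t) x = 0) ∧
      ∀ x ∈ frontier (unitCylinder : Set ℝ³), ⟪pathVel L G t x, eR x⟫_ℝ = 0 := by
  obtain ⟨δ, hW⟩ := h.windowed
  obtain ⟨ρ, hP⟩ := h.cellPath
  exact hW.divergence_pathVel_eq_zero hs hP ht hv

end Runs

end PeriodicCylinder

end Literature.Analysis.FluidPDE
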